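import Summits.CriticalPhenomena.PercolationContinuityZ3.Theorems.PercNearOneGluingNoHeavyLowerTailSahiMixtureChainMoments
import Literature.Combinatorics.Sahi2008.ProductOfChains
import HarnessLib

/-!
# Two-factor moments: events conditionally independent given two independent chain-valued factors, with bi-monotone
# conditional probabilities, are Sahi-positive at every order

Support file of the one-cut programme (crux `NoHeavyLowerTail`, stmt-CriticalPhenomena-4575; cell `prim-masterthm`, seat P3, gen 15;
`run/shared/lean/prim/prim-masterthm/prim-masterthm-p3/HIERARCHY.md` §23; memo
`run/shared/lean/prim/prim-masterthm/FROM-prim-masterthm-p3-g15-MONOTONE-MIXTURES.md` §3(e)).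

THE PRINCIPLE (memo §3(e)).  A family of events that is conditionally independent given a latent variable `θ ∈ Θ` with conditional probabilities `y_i(θ)` has,
for distinct members, the same mixed moments as the functions `y_i` on `Θ`; since `E_m` is a function of those moments (`sahiE_congr_of_moments`), every proved
case of Sahi's conjecture for FUNCTIONS on a latent space `Θ` gives Sahi positivity at every order for the corresponding conditionally independent EVENT models.
`…SahiMixtureChainMoments` did this for a chain (Blinovsky's Lemma 1).  THIS FILE does it for the product of TWO finite chains with a PRODUCT weight, using
Lieb–Sahi's Theorem 3.7 in the tree's form `ProductChains.sahiPositive_prodWeight_linearOrder`: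
**`sahiE_nonneg_of_twoChainMoments`** — if `E[Π_r 1_{A_{e r}}] = Σ_{θ,θ'} w_θ w'_{θ'} Π_r y_{θ,θ',e r}` for all injective `e`, with `w, w' ≥ 0` of mass `1` and `y ≥ 0`
nondecreasing in EACH factor, then `E_n(1_{A_0},…,1_{A_{n−1}}) ≥ 0` (every `n`; sub-families `…_sub`).  Examples: two-factor threshold models
`A_i = {Z + Z' + ε_i ≥ τ_i}` with independent discrete `Z, Z'`; an MMP law with an independent coin OR-ed or AND-ed into any sub-collection of members (the second
factor is the coin — this is how `…SahiMixtureMonotoneCells` proves that every cell of the mixture ladder is `≥ 0` on MMP).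
HONEST FRAMING: nothing here asserts (M⁺-k) or `C_k` for `k ≥ 3`.  Everything PROVED, standard axioms, definition-free. [this work]
-/

noncomputable section

open scoped Classical

namespace Summit.CriticalPhenomena.PercolationContinuityZ3.Theorems

open Finset Function
open Literature.Combinatorics.Sahi2008
open Literature.Probability.Percolation.DecisionTree (ind ind_of_mem ind_of_not_mem ind_nonneg)

namespace SahiMixture

section TwoFactor

variable {α : Type*} [Fintype α] {L L' n : ℕ}

/-- **Sahi positivity of every order from two-factor chain moments.**  Events `A_0,…,A_{n−1}` whose distinct-index moments are
`E[Π_r 1_{A_{e r}}] = Σ_θ Σ_θ' w_θ w'_θ' Π_r y_{θ,θ',e r}` with `w, w' ≥ 0` of mass one, `y ≥ 0`, and `y_{·,θ',i}`, `y_{θ,·,i}` nondecreasing: then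
`E_n(1_{A_0},…,1_{A_{n−1}}) ≥ 0`.  Moment transfer to the product of the two chains `Fin L × Fin L'` with the product weight, then Lieb–Sahi's Theorem 3.7
(`ProductChains.sahiPositive_prodWeight_linearOrder`). [this work] -/
theorem sahiE_nonneg_of_twoChainMoments (μ : α → ℝ) (A : Fin n → Set α)
    (w : Fin L → ℝ) (hw0 : ∀ θ, 0 ≤ w θ) (hw1 : ∑ θ, w θ = 1) (w' : Fin L' → ℝ) (hw'0 : ∀ θ', 0 ≤ w' θ') (hw'1 : ∑ θ', w' θ' = 1)
    (y : Fin L → Fin L' → Fin n → ℝ) (hy0 : ∀ θ θ' i, 0 ≤ y θ θ' i)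
    (hmono₁ : ∀ θ' i, Monotone (fun θ => y θ θ' i)) (hmono₂ : ∀ θ i, Monotone (fun θ' => y θ θ' i))
    (hmom : ∀ (k : ℕ) (e : Fin k → Fin n), Function.Injective e →
      ex μ (∏ r, ind (A (e r))) = ∑ θ, ∑ θ', w θ * w' θ' * ∏ r, y θ θ' (e r)) :
    0 ≤ sahiE μ n (fun j => ind (A j)) := by
  have hL : Nonempty (Fin L) := by
    rcases Nat.eq_zero_or_pos L with h | h
    · subst h; simp at hw1
    · exact ⟨⟨0, h⟩⟩
  have hL' : Nonempty (Fin L') := by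
    rcases Nat.eq_zero_or_pos L' with h | h
    · subst h; simp at hw'1
    · exact ⟨⟨0, h⟩⟩
  let W : Fin L × Fin L' → ℝ := fun p => w p.1 * w' p.2
  let g : Fin n → Fin L × Fin L' → ℝ := fun j p => y p.1 p.2 j
  have hW : SahiPositive W n := ProductChains.sahiPositive_prodWeight_linearOrder w w' hw0 hw1 hw'0 hw'1 n
  have hg0 : ∀ j p, 0 ≤ g j p := fun j p => hy0 p.1 p.2 j
  have hgm : ∀ j, Monotone (g j) := by
    intro j p q hpq
    exact (hmono₁ p.2 j hpq.1).trans (hmono₂ q.1 j hpq.2)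
  rw [sahiE_congr_of_moments μ W (fun j => ind (A j)) g ?_]
  · exact hW g hg0 hgm
  · intro k e he
    rw [hmom k e he, ex_def, Fintype.sum_prod_type]
    refine Finset.sum_congr rfl fun θ _ => Finset.sum_congr rfl fun θ' _ => ?_
    simp only [W, g, Finset.prod_apply]

/-- **Sub-families** under two-factor chain moments: `E_m(1_{A_{s 0}},…,1_{A_{s(m−1)}}) ≥ 0` for every injective `s`. [this work] -/
theorem sahiE_nonneg_of_twoChainMoments_sub (μ : α → ℝ) (A : Fin n → Set α)
    (w : Fin L → ℝ) (hw0 : ∀ θ, 0 ≤ w θ) (hw1 : ∑ θ, w θ = 1) (w' : Fin L' → ℝ) (hw'0 : ∀ θ', 0 ≤ w' θ') (hw'1 : ∑ θ', w' θ' = 1)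
    (y : Fin L → Fin L' → Fin n → ℝ) (hy0 : ∀ θ θ' i, 0 ≤ y θ θ' i)
    (hmono₁ : ∀ θ' i, Monotone (fun θ => y θ θ' i)) (hmono₂ : ∀ θ i, Monotone (fun θ' => y θ θ' i))
    (hmom : ∀ (k : ℕ) (e : Fin k → Fin n), Function.Injective e →
      ex μ (∏ r, ind (A (e r))) = ∑ θ, ∑ θ', w θ * w' θ' * ∏ r, y θ θ' (e r))
    {m : ℕ} (s : Fin m → Fin n) (hs : Function.Injective s) :
    0 ≤ sahiE μ m (fun j => ind (A (s j))) :=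
  sahiE_nonneg_of_twoChainMoments μ (A ∘ s) w hw0 hw1 w' hw'0 hw'1 (fun θ θ' j => y θ θ' (s j)) (fun θ θ' j => hy0 θ θ' (s j))
    (fun θ' j => hmono₁ θ' (s j)) (fun θ j => hmono₂ θ (s j)) fun k e he => hmom k (s ∘ e) (hs.comp he)

end TwoFactor

end SahiMixture

end Summit.CriticalPhenomena.PercolationContinuityZ3.Theorems

end
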